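import Summits.QuantumFields.YangMills.Theorems.UnitScaleTiltProp7PinnedSupOfGradient
import Summits.QuantumFields.YangMills.Theorems.UnitScaleTiltProp7ExactCorrectorGaugeSockets
import Literature.MathematicalPhysics.QuantumFieldTheory.Balaban1983to89.T3ContinuumYM3Torus
import HarnessLib

/-!
# Route `UnitScaleTilt`, crux K1 «MinimiserStabilityRegPr» (stmt-QuantumFields-19200), route-R E′ path (α′), the (E1) pinned-slice corrector —
# (E1-X1) READING FILE: the ANY-CENTRE pointwise pinned row and its PIN-CONE PRODUCT COMPANION at the (E1) row's letters
# (`F : T3Family`, `W : GaugeField (F.P K) 0 SU(N)` read through `unitsField ∘ toUField`, centres `embIter (K − n)`), over ✓ `…PinnedSupOfGradient`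

Cell `ym3-torus`, width seat `ym3-torus-px9` (gen 3); `--kind proof --supports stmt-QuantumFields-19200 --as helper`, count-neutral.  THEOREMS ONLY (0 `def`,
0 `sorry`).  YM₃ on T³ is a RUNG of the ladder (R3) — not d = 4, not infinite volume, not a mass gap, not the Clay problem; nothing here claims the stub, the crux
or any summit statement.

THE POINT (px4 g2 hazard #54 (3), px15 g2 (E1-c) F4, ★p1 g15 (E1-e) knit).  ✓`Prop7PinnedSupOfGradient` (routeR-w3 g6) proves the covariant ℓ¹-Lipschitz row
`‖f x‖ − ‖f y‖ ≤ tdist(y, x)·a` and the own-centre sup row `‖ψ x‖ ≤ (d∕2)·L^k·a` for pinned `ψ`.  The (E1) consumers read two further SHAPES of the same fact, typed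
here once BY NAME over that file (no estimate re-proved): (r1) the ANY-CENTRE form `‖ψ x‖ ≤ tdist(x, embIter k y)·a` for EVERY centre `y` — the set-distance currency
`dist(x, C)` in which the weight `min(dist(x, C), ℓ)` of the second-order row `ρ₃` is written; (r2) the PIN-CONE PRODUCT COMPANION
`ℓ²·(‖ψ x‖·‖g x‖) ≤ (ℓ·a)·(ℓ·(tdist(x, embIter k y)·‖g x‖))` for any site quantity `g` (`g := Δ_Wψ` at the call): the only place the (E1) scheme meets the
Laplacian row is the product `‖ψ(x)‖·‖Δ_Wψ(x)‖` (from `D*_W[ψ, D_Wψ] ∋ [ψ, Δ_Wψ]`), and the weight vanishing ON `C` is what tames the d = 3 pin cone; (r3) both,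
and the own-centre row at `d = 3`, at the (E1) row's letters with the background letter `hU` DISCHARGED by ✓`unitsField_toUField_norm_le_one` and the standing range
`K − n ≤ m + K` discharged.

WHAT IS PROVED (ns `…Theorems.Prop7PinnedCovSupRowT3`):
* §1 (any `P`, `j = 0`, normed ring `𝔸`, `‖U‖, ‖U⁻¹‖ ≤ 1`): ★ `norm_le_tdist_mul_of_pinned` (r1), `sq_mul_norm_mul_le_of_pinned` (r2).
* §2 (run `K` of a T³ family, level `K − n`, `SU(N)` background): `level_le`, ★★ `norm_le_tdist_mul_of_pinned_T3`, ★★ `norm_le_of_pinned_T3`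
  (`‖ψ x‖ ≤ (3∕2)·L^{K−n}·a` — on pinned fields the `X`-norm's zeroth row is at most `3∕2` times its first row), `sq_mul_norm_mul_le_of_pinned_T3`.
HONEST SCOPE.  Readings of ✓`Prop7PinnedSupOfGradient.norm_sub_norm_le_tdist_mul` ∕ `norm_le_of_vanish_centres` plus one line of algebra; no analytic input;
nothing of [Balaban1985BackgroundPropagators] ∕ [Balaban1985Variational] beyond the cited tree letters is asserted.

References: T. Bałaban, CMP 99 (1985) 389–434 [Balaban1985BackgroundPropagators] ((3.3) p.390); CMP 109 (1987) 249–301 [Balaban1987RG1] ((0.1) p.251);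
CMP 102 (1985) 277–309 [Balaban1985Variational] (Prop. 7 p.299).
-/

set_option autoImplicit false

open scoped BigOperators

namespace Summit.QuantumFields.YangMills.Theorems.Prop7PinnedCovSupRowT3

open Literature.MathematicalPhysics.QuantumFieldTheory.Balaban1983to89
open B9Eq39Adjoint (covD)
open B9TorusCalculus (torusT)
open B15DeterminingSets (embIter)
open Summit.QuantumFields.YangMills.Theorems.Prop7PinnedSupOfGradient (norm_sub_norm_le_tdist_mul norm_le_of_vanish_centres)

/-! ## §1 The any-centre pointwise pinned row and the pin-cone product companion -/

section Pinned

variable {𝔸 : Type*} [NormedRing 𝔸] {P : Params}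

/-- ★ (r1) **ANY CENTRE**: if `ψ` vanishes at every `k`-centre and `‖(D_Uψ)(x,μ)‖ ≤ a` on every bond (norm-one transports), then `‖ψ x‖ ≤ tdist(x, embIter k y)·a`
for EVERY `y` — in particular for the nearest centre (`dist(x, C)`). [cite: Balaban1985BackgroundPropagators, (3.3) p.390] -/
theorem norm_le_tdist_mul_of_pinned (U : Fin P.d → Site P 0 → 𝔸ˣ)
    (hU : ∀ (κ : Fin P.d) (y : Site P 0), ‖(U κ y : 𝔸)‖ ≤ 1 ∧ ‖(((U κ y)⁻¹ : 𝔸ˣ) : 𝔸)‖ ≤ 1)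
    (ψ : Site P 0 → 𝔸) {k : ℕ} (h0 : ∀ y : Site P k, ψ (embIter k y) = 0)
    {a : ℝ} (ha : ∀ (μ : Fin P.d) (x : Site P 0), ‖covD (torusT P 0) U μ ψ x‖ ≤ a) (x : Site P 0) (y : Site P k) :
    ‖ψ x‖ ≤ (Site.tdist x (embIter k y) : ℝ) * a := by
  have h := norm_sub_norm_le_tdist_mul U hU ψ ha (embIter k y) x
  rw [h0, norm_zero, sub_zero] at h
  have hc : Site.tdist x (embIter k y) = Site.tdist (embIter k y) x := by
    unfold Site.tdist
    exact Finset.sum_congr rfl fun μ _ => min_comm _ _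
  rw [hc]
  exact h

/-- (r2) **THE PIN-CONE PRODUCT COMPANION**: for any site quantity `g` (`g := Δ_Uψ` at the call), any centre `y` and any real `ℓ`,
`ℓ²·(‖ψ x‖·‖g x‖) ≤ (ℓ·a)·(ℓ·(tdist(x, embIter k y)·‖g x‖))` — the zeroth row times the second is the first row times the DIST-WEIGHTED second row,
which vanishes on `C`. [cite: Balaban1985BackgroundPropagators, (3.3) p.390] -/
theorem sq_mul_norm_mul_le_of_pinned (U : Fin P.d → Site P 0 → 𝔸ˣ)
    (hU : ∀ (κ : Fin P.d) (y : Site P 0), ‖(U κ y : 𝔸)‖ ≤ 1 ∧ ‖(((U κ y)⁻¹ : 𝔸ˣ) : 𝔸)‖ ≤ 1)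
    (ψ : Site P 0 → 𝔸) {k : ℕ} (h0 : ∀ y : Site P k, ψ (embIter k y) = 0)
    {a : ℝ} (ha : ∀ (μ : Fin P.d) (x : Site P 0), ‖covD (torusT P 0) U μ ψ x‖ ≤ a)
    {V : Type*} [SeminormedAddCommGroup V] (g : Site P 0 → V) (ℓ : ℝ) (x : Site P 0) (y : Site P k) :
    ℓ ^ 2 * (‖ψ x‖ * ‖g x‖) ≤ (ℓ * a) * (ℓ * ((Site.tdist x (embIter k y) : ℝ) * ‖g x‖)) := by
  have h := norm_le_tdist_mul_of_pinned U hU ψ h0 ha x y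
  have h2 : ‖ψ x‖ * ‖g x‖ ≤ ((Site.tdist x (embIter k y) : ℝ) * a) * ‖g x‖ := mul_le_mul_of_nonneg_right h (norm_nonneg _)
  calc ℓ ^ 2 * (‖ψ x‖ * ‖g x‖) ≤ ℓ ^ 2 * (((Site.tdist x (embIter k y) : ℝ) * a) * ‖g x‖) := mul_le_mul_of_nonneg_left h2 (sq_nonneg ℓ)
    _ = (ℓ * a) * (ℓ * ((Site.tdist x (embIter k y) : ℝ) * ‖g x‖)) := by ring

end Pinned

/-! ## §2 The E′ reading: run `K` of a T³ family, level `K − n`, `SU(N)` background read through `unitsField ∘ toUField` -/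

section T3

open scoped Matrix.Norms.L2Operator
open B10Eq27TorusAxialLog (unitsField toUField)
open T3ContinuumYM3Torus (T3Family)
open Summit.QuantumFields.YangMills.Theorems.Prop7ExactCorrectorGaugeSockets (unitsField_toUField_norm_le_one)

variable {N : ℕ} [NeZero N]

omit [NeZero N] in
/-- The standing range of the level `K − n` on run `K`: `K − n ≤ m + K`. [cite: Balaban1987RG1, (0.1) p.251] -/
theorem level_le (F : T3Family) (K n : ℕ) : K - n ≤ (F.P K).m + (F.P K).K := by
  have := F.hm
  show K - n ≤ F.m + K
  omega

/-- ★★ (r1) AT THE (E1) ROW'S LETTERS: for `ψ : Site (F.P K) 0 → M_N(ℂ)` pinned at the `(K − n)`-centres with `‖(D_Wψ)(x, μ)‖ ≤ a` on every bond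
(`D_W = covD (torusT _ 0) (unitsField (toUField W))`), `‖ψ x‖ ≤ tdist(x, embIter (K − n) y)·a` for every `y`.
[cite: Balaban1985BackgroundPropagators, (3.3) p.390; Balaban1985Variational, Prop. 7 p.299] -/
theorem norm_le_tdist_mul_of_pinned_T3 (F : T3Family) (K n : ℕ) (W : GaugeField (F.P K) 0 (Matrix.specialUnitaryGroup (Fin N) ℂ))
    (ψ : Site (F.P K) 0 → Matrix (Fin N) (Fin N) ℂ) (h0 : ∀ y : Site (F.P K) (K - n), ψ (embIter (K - n) y) = 0) {a : ℝ}
    (ha : ∀ (μ : Fin (F.P K).d) (x : Site (F.P K) 0), ‖covD (torusT (F.P K) 0) (fun κ z => unitsField (toUField W) ⟨z, κ⟩) μ ψ x‖ ≤ a)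
    (x : Site (F.P K) 0) (y : Site (F.P K) (K - n)) :
    ‖ψ x‖ ≤ (Site.tdist x (embIter (K - n) y) : ℝ) * a :=
  norm_le_tdist_mul_of_pinned (fun κ z => unitsField (toUField W) ⟨z, κ⟩) (fun μ z => unitsField_toUField_norm_le_one W ⟨z, μ⟩) ψ h0 ha x y

/-- ★★ OWN CENTRE AT d = 3: `‖ψ x‖ ≤ (3∕2)·L^{K−n}·a` — on the pinned fields of the (E1) corrector the `X`-norm's zeroth row `sup‖ψ‖` is at most `3∕2` times its first
row `ℓ·sup‖D_Wψ‖`, `ℓ = L^{K−n}` (✓`norm_le_of_vanish_centres` with `d = 3`, `hU` and the level range discharged).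
[cite: Balaban1985BackgroundPropagators, (3.3) p.390; Balaban1985Variational, Prop. 7 p.299] -/
theorem norm_le_of_pinned_T3 (F : T3Family) (K n : ℕ) (W : GaugeField (F.P K) 0 (Matrix.specialUnitaryGroup (Fin N) ℂ))
    (ψ : Site (F.P K) 0 → Matrix (Fin N) (Fin N) ℂ) (h0 : ∀ y : Site (F.P K) (K - n), ψ (embIter (K - n) y) = 0) {a : ℝ}
    (ha : ∀ (μ : Fin (F.P K).d) (x : Site (F.P K) 0), ‖covD (torusT (F.P K) 0) (fun κ z => unitsField (toUField W) ⟨z, κ⟩) μ ψ x‖ ≤ a)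
    (x : Site (F.P K) 0) :
    ‖ψ x‖ ≤ 3 / 2 * (F.L : ℝ) ^ (K - n) * a := by
  have h := norm_le_of_vanish_centres (level_le F K n) (fun κ z => unitsField (toUField W) ⟨z, κ⟩)
    (fun μ z => unitsField_toUField_norm_le_one W ⟨z, μ⟩) ψ h0 ha x
  have hd : (F.P K).d = 3 := rfl
  have hL : (F.P K).L = F.L := rfl
  rw [hd, hL] at h
  simpa only [Nat.cast_ofNat] using h

/-- (r2) AT THE (E1) ROW'S LETTERS: `ℓ²·(‖ψ x‖·‖g x‖) ≤ (ℓ·a)·(ℓ·(tdist(x, embIter (K − n) y)·‖g x‖))` for any site quantity `g` (`g := Δ_Wψ`), any centre `y`,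
any real `ℓ`. [cite: Balaban1985BackgroundPropagators, (3.3) p.390; Balaban1985Variational, Prop. 7 p.299] -/
theorem sq_mul_norm_mul_le_of_pinned_T3 (F : T3Family) (K n : ℕ) (W : GaugeField (F.P K) 0 (Matrix.specialUnitaryGroup (Fin N) ℂ))
    (ψ : Site (F.P K) 0 → Matrix (Fin N) (Fin N) ℂ) (h0 : ∀ y : Site (F.P K) (K - n), ψ (embIter (K - n) y) = 0) {a : ℝ}
    (ha : ∀ (μ : Fin (F.P K).d) (x : Site (F.P K) 0), ‖covD (torusT (F.P K) 0) (fun κ z => unitsField (toUField W) ⟨z, κ⟩) μ ψ x‖ ≤ a)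
    {V : Type*} [SeminormedAddCommGroup V] (g : Site (F.P K) 0 → V) (ℓ : ℝ) (x : Site (F.P K) 0) (y : Site (F.P K) (K - n)) :
    ℓ ^ 2 * (‖ψ x‖ * ‖g x‖) ≤ (ℓ * a) * (ℓ * ((Site.tdist x (embIter (K - n) y) : ℝ) * ‖g x‖)) :=
  sq_mul_norm_mul_le_of_pinned (fun κ z => unitsField (toUField W) ⟨z, κ⟩) (fun μ z => unitsField_toUField_norm_le_one W ⟨z, μ⟩) ψ h0 ha g ℓ x y

end T3

end Summit.QuantumFields.YangMills.Theorems.Prop7PinnedCovSupRowT3
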